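import Summits.Langlands.Langlands.Theses.ImageOrderLadder

/-!
# Route ImageOrderLadder — Assembly

The assembly item (stmt-Langlands-28019) of the child route `ImageOrderLadder` (decomp-langlands lens-1 gen 24; V-R refining child
`--refines route-Langlands-TameDarkSplit:HigherRankArtinAutomorphy`, edge split, depth 1; first child of `TameDarkSplit`) for
AD = `TameDarkSplit.HigherRankArtinAutomorphy` (stmt-Langlands-33248):
`SmallSolvableArtinAutomorphy → FirstDarkOrderArtinAutomorphy → LargeOrInsolubleArtinAutomorphy → TameDarkSplit.HigherRankArtinAutomorphy`.

This is literally the type of the route file's sorry-free deciding theorem `Summit.Langlands.Langlands.Theses.ImageOrderLadder.closes`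
(two excluded middles on the inserted hypotheses: twist-minimal solvable image order ≤ 107 ∣ = 108 ∣ the rest).
Nothing here proves `Langlands` (nor the parent piece): the assembly records only that the three cells of the route (SMALL, DARK108 and the declared
residual REST), taken together, imply the parent piece by name.  The census instrument I-g24.1 (kit j342917) confirmed the lens's order-108 census:
the dark content of DARK108 is the eight faithful degree-3 characters of SmallGroup(108,15) (projective image (36,9) = H₃₆).
-/

set_option linter.dupNamespace false -- project-wide option (lakefile weak.linter.dupNamespace); `Summit.Langlands.Langlands` is the mandated namespace

namespace Summit.Langlands.Langlands.Theorems

/-- **Assembly of route ImageOrderLadder** (stmt-Langlands-28019):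
`SmallSolvableArtinAutomorphy → FirstDarkOrderArtinAutomorphy → LargeOrInsolubleArtinAutomorphy → TameDarkSplit.HigherRankArtinAutomorphy`.
Proof: unfold `Assembly` and apply the route's deciding theorem `Theses.ImageOrderLadder.closes`. -/
theorem imageOrderLadder_assembly_proof :
    Summit.Langlands.Langlands.Theses.ImageOrderLadder.Assembly := by
  unfold Summit.Langlands.Langlands.Theses.ImageOrderLadder.Assembly
  exact Summit.Langlands.Langlands.Theses.ImageOrderLadder.closes

end Summit.Langlands.Langlands.Theorems
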